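import Summits.QuantumFields.YangMills.Theorems.LuscherReductionTwistedTraceScalingRecordInequalities
import HarnessLib

/-!
# C4-CORE(s) ⟸ THE ANALYTIC INPUT ALONE: `RecordAnalyticInput L s M` (fibre profile + (B-T) + (B-ST) + (B-OD)) ⇒ `InnerNoIntruderOneOrbitAt L β^{-s}`
# (lane A of S-BASE, crux `TwistedTraceScaling` stmt-QuantumFields-20203, C4 INNER; design note `pub/ym-fleet/ym-luscher-20007-p1/COARSE-DESIGN.md` §24.9–§24.11)

The hand-off object.  With every structural field of `RecordBOInput` now in the tree (`recordChi_shadow`, `record_structural_inequalities`, `boBricks_record`), what remains of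
C4-CORE(s), s ∈ (1/6, 1/5), is PURELY ANALYTIC and is typed here as `RecordAnalyticInput L s M` (weight `recordChi L s 43 M`, window `{orbitDist₁ < recordDelta1 L s β}`):
a fibre profile family `Ω` (measurable, `|Ω| ≤ 1`, colour blind, supported in `{‖x‖ ≤ r β}` with `12|Site|·r < β^{-s}` eventually, `recordGamma > 0`), rates `κ` (`Cβ^{-2s}·43² ≤ κ = o(λ_b)`),
`b` (`b² = o(λ_b)`), `σ > 0`, `θ₀ ∈ (0,1]`, and the three bricks (B-T) `hT`, (B-ST) `hST`, (B-OD) `hOD` exactly as in `RecordBOInput`.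
* `RecordAnalyticInput.toRecordBOInput`;
* ★★★ `innerNoIntruderOneOrbitAt_of_analyticInput (hL : Nonempty (NzSite L)) (hs : 0 < s) (hs5 : s < 1/5) : ∃ M₀ ≥ 2, ∀ M ≥ M₀, RecordAnalyticInput L s M → InnerNoIntruderOneOrbitAt L (powScale s)`.
HONEST FRAMING: the analytic bricks are OPEN (they are Lüscher's §3 Born–Oppenheimer analysis made quantitative); C4-CORE OPEN; stub of a child of the CONDITIONAL route R2b1;
not infinite volume, not a gap, not Clay.
-/

set_option autoImplicit false

noncomputable section

open MeasureTheory Filter Topology Real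
open scoped BigOperators
open Literature.MathematicalPhysics.QuantumFieldTheory
open Literature.MathematicalPhysics.QuantumLattice

namespace Summit.QuantumFields.YangMills.Theorems.FemtoTransferGap.TwoLattice.ConstTube

open Summit.QuantumFields.YangMills.Theorems.FemtoTransferGap
open Summit.QuantumFields.YangMills.Theorems.FemtoTransferGap.TwoLattice.Stiff (LinkSpace)

variable (L : ℕ) [NeZero L]

/-- **THE ANALYTIC INPUT** for C4-CORE(s) at fat factor `M` (orbit factor `K = 43`, window radius `recordDelta1 L s`). [cite: Luscher1983, §3] [cite: SjostrandZworski2007, §2] -/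
structure RecordAnalyticInput (s M : ℝ) where
  /-- fibre profile and its support radius; fibre energy factor; rates; stiff gap -/
  Ω : ℝ → LinkSpace L → ℝ
  r : ℝ → ℝ
  σ : ℝ → ℝ
  κ : ℝ → ℝ
  b : ℝ → ℝ
  θ₀ : ℝ
  hΩm : ∀ β, Measurable (Ω β)
  hΩ1 : ∀ β x, |Ω β x| ≤ 1
  hΩinv : ∀ β (g : SU2) (v : LinkSpace L), Ω β (adL L g v) = Ω β v
  hΩr : ∀ β x, Ω β x ≠ 0 → ‖x‖ ≤ r β
  hr : ∀ β, 0 ≤ r β ∧ r β ≤ 1 / 2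
  hr_small : ∀ᶠ β in atTop, 12 * Fintype.card (Site 3 L) * r β < powScale s β
  hγ : ∀ β, 0 < recordGamma L Ω β
  hσ : ∀ β, 0 < σ β
  hκ0 : ∀ β, 0 ≤ κ β
  hκ_dom : ∀ C : ℝ, ∀ᶠ β in atTop, C * (43 * powScale s β) ^ 2 ≤ κ β
  hκ_small : ∀ a : ℝ, 0 < a → ∀ᶠ β in atTop, κ β ≤ a * bareLambda ((L : ℝ) ^ 3 * β)
  hb : ∀ β, 0 ≤ b β
  hb_small : ∀ a : ℝ, 0 < a → ∀ᶠ β in atTop, b β ^ 2 ≤ a * bareLambda ((L : ℝ) ^ 3 * β)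
  hθ₀ : 0 < θ₀ ∧ θ₀ ≤ 1
  /-- (B-T) the kernel on BO functions (see `boKernel`, `tubeForm_boFun_eq`) -/
  hT : ∀ᶠ β in atTop, ∀ φ : GaugeConfig 3 1 SU2 → ℝ, Measurable φ → (∃ C : ℝ, ∀ u, |φ u| ≤ C) →
    (∀ (g : Site 3 1 → SU2) (u : GaugeConfig 3 1 SU2), φ (gaugeTransform g u) = φ u) → (∀ u, φ u ≠ 0 → orbitDist u < recordDelta1 L s β) →
    |tubeForm β (boFun L φ (Ω β)) - σ β * recordGamma L Ω β * qform su2Rep ((L : ℝ) ^ 3 * β) φ φ| ≤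
      κ β * (σ β * recordGamma L Ω β) * (qform su2Rep ((L : ℝ) ^ 3 * β) φ φ + levelValue su2Rep 1 ((L : ℝ) ^ 3 * β) 0 * l2 φ φ)
  /-- (B-ST) stiff domination -/
  hST : ∀ᶠ β in atTop, ∀ v : GaugeConfig 3 L SU2 → ℝ, Measurable v → (∃ C : ℝ, ∀ U, |v U| ≤ C) → (∀ U, v U ≠ 0 → recordChi L s 43 M β U ≠ 0) →
    (∀ u, fibreInner L (softWeight (recordChi L s 43 M β)) (Ω β) v u = 0) →
    tubeForm β v ≤ (1 - θ₀) * (σ β * levelValue su2Rep 1 ((L : ℝ) ^ 3 * β) 0) * tubeNormSq (softWeight (recordChi L s 43 M β)) v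
  /-- (B-OD) off-diagonal -/
  hOD : ∀ᶠ β in atTop, ∀ (φ : GaugeConfig 3 1 SU2 → ℝ) (v : GaugeConfig 3 L SU2 → ℝ), Measurable φ → (∃ C : ℝ, ∀ u, |φ u| ≤ C) →
    (∀ u, φ u ≠ 0 → orbitDist u < recordDelta1 L s β) → Measurable v → (∃ C : ℝ, ∀ U, |v U| ≤ C) → (∀ U, v U ≠ 0 → recordChi L s 43 M β U ≠ 0) →
    (∀ u, fibreInner L (softWeight (recordChi L s 43 M β)) (Ω β) v u = 0) →
    |tubeCross β (boFun L φ (Ω β)) v| ≤ b β * (σ β * levelValue su2Rep 1 ((L : ℝ) ^ 3 * β) 0) *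
        Real.sqrt (tubeNormSq (softWeight (recordChi L s 43 M β)) (boFun L φ (Ω β))) * Real.sqrt (tubeNormSq (softWeight (recordChi L s 43 M β)) v) ∧
    |tubeCross β v (boFun L φ (Ω β))| ≤ b β * (σ β * levelValue su2Rep 1 ((L : ℝ) ^ 3 * β) 0) *
        Real.sqrt (tubeNormSq (softWeight (recordChi L s 43 M β)) (boFun L φ (Ω β))) * Real.sqrt (tubeNormSq (softWeight (recordChi L s 43 M β)) v)

variable {L}

/-- The analytic input extends to the full record input (all structural fields from the tree). [folklore] -/
def RecordAnalyticInput.toRecordBOInput {s M : ℝ} (hs : 0 < s) (hs5 : s < 1 / 5) (hM : 0 ≤ M) (A : RecordAnalyticInput L s M) : RecordBOInput L s 43 M :=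
  have hSI := record_structural_inequalities (L := L) hs hs5 A.hr_small
  { Ω := A.Ω, r := A.r, δ₁ := recordDelta1 L s, σ := A.σ, κ := A.κ, b := A.b, θ₀ := A.θ₀,
    hΩm := A.hΩm, hΩ1 := A.hΩ1, hΩinv := A.hΩinv, hΩr := A.hΩr, hr := A.hr, hγ := A.hγ,
    hδ₁ := hSI.1, hcore := hSI.2.1, hradii := hSI.2.2.1, hshadow := hSI.2.2.2 43 M (by norm_num) hM,
    hσ := A.hσ, hκ0 := A.hκ0, hκ_dom := A.hκ_dom, hκ_small := A.hκ_small, hb := A.hb, hb_small := A.hb_small, hθ₀ := A.hθ₀,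
    hT := A.hT, hST := A.hST, hOD := A.hOD }

/-- ★★★ **C4-CORE(s) FROM THE ANALYTIC INPUT ALONE** (`L` with a nonzero site, `0 < s < 1/5`; for the rates to be consistent one needs `s > 1/6`, which is where `hκ_dom ∧ hκ_small`
is satisfiable). [cite: Luscher1983, §3] -/
theorem innerNoIntruderOneOrbitAt_of_analyticInput (hL : Nonempty (NzSite L)) {s : ℝ} (hs : 0 < s) (hs5 : s < 1 / 5) :
    ∃ M₀ : ℝ, 2 ≤ M₀ ∧ ∀ M : ℝ, M₀ ≤ M → RecordAnalyticInput L s M → InnerNoIntruderOneOrbitAt L (powScale s) := by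
  obtain ⟨M₀, hM₀, h⟩ := innerNoIntruderOneOrbitAt_of_recordInput (L := L) hL hs (by linarith) (K := 43) (by norm_num)
  exact ⟨M₀, hM₀, fun M hM A => h M hM (A.toRecordBOInput hs hs5 (by linarith))⟩

end Summit.QuantumFields.YangMills.Theorems.FemtoTransferGap.TwoLattice.ConstTube

end
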